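import Summits.ResolutionOfSingularities.ResolutionOfSingularities.Theorems.RadicialJungCleanModelsPBasisLogContentSpan
import Summits.ResolutionOfSingularities.ResolutionOfSingularities.Theorems.RadicialJungCleanModelsPBasisMonomialIdeal
import Literature.AlgebraicGeometry.Resolution.GiraudLogJacobianIdeal
import HarnessLib

/-!
# Route `RadicialJung`, crux `CleanModels` (stmt-15917): Giraud's `J(X, f)`, `J(X, f, E(f))` at a
# point with given critical primes, read on a `p`-basis (Giraud 1983, 1.1–1.3, 2.5)

Support file (OURS) for PROGRAMME-clean-dim2 / T2 (`stub_lemma23`), line `via-clean-models` of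
the crux `DescentPerfectToAll` (stmt-0549). Nothing here is a statement of Hironaka's manuscript.

For a ring `O` of characteristic `p` with a `p`-basis `Γ ∋ x, y` (`x ≠ y`) over `O^p` and dual
derivations `δ` (Kimura–Niitsuma; `Literature/RingTheory/PBasis/`), and `f ∈ O`, with
`N = (δ_u f : u ∈ Γ ∖ {x, y})`:

* `derivJacobianIdeal_eq_span_dual` — `J(O, f) = (δ_x f, δ_y f) + N` (the intrinsic
  `derivJacobianIdeal` of `GiraudLogJacobianIdeal.lean`);
* `logDerivJacobianIdeal_eq_span_dual_of_criticalPrimes_eq` — **if the critical primes of `f`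
  are exactly `{(x)}` (a non-crossing point of `E(f) = div(x)`), then
  `J(O, f, E(f)) = (x δ_x f, δ_y f) + N`**; `logDerivJacobianIdeal_eq_span_dual_of_criticalPrimes_eq₂`
  — if they are `{(x), (y)}` (a crossing point), `J(O, f, E(f)) = (x δ_x f, y δ_y f) + N`
  (Giraud 1.1 (3): "engendré par les `x_i ∂f/∂x_i` tels que `a(i) ≠ 0` et les `∂f/∂x_j` tels que
  `a(j) = 0`");
* `mem_range_frobenius_of_forall_dual_apply_eq_zero` — if every `δ_γ f` vanishes then `f ∈ O^p`;
  hence `derivJacobianIdeal_ne_bot` / `logDerivJacobianIdeal_ne_bot…` for `f ∉ O^p` (Giraud's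
  standing hypothesis "`f` n'est pas une puissance `p`-ième", 2.4).

References: J. Giraud, Bull. SMF 111 (1983), 1.1 (2)–(3), 1.3, 2.4–2.5 [Giraud1983].
-/

noncomputable section

set_option linter.dupNamespace false -- mandated namespace of this single-conjunct summit

open Literature.RingTheory.PBasis Literature.AlgebraicGeometry.Resolution

namespace Summit.ResolutionOfSingularities.ResolutionOfSingularities.Theorems.RadicialJung.CleanModels

universe u

variable {p : ℕ} [Fact p.Prime] {O : Type u} [CommRing O] [CharP O p] {Γ : Set O}
  (δ : Γ → Derivation ℤ O O) (hδ₁ : ∀ γ : Γ, δ γ (γ : O) = 1)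
  (hδ₀ : ∀ γ γ' : Γ, γ' ≠ γ → δ γ (γ' : O) = 0) {x y : O} (hx : x ∈ Γ) (hy : y ∈ Γ)

/-! ## `J(O, f)` and `J(O, f, E(f))` in terms of the dual derivations -/

include hδ₁ hδ₀ in
/-- **`J(O, f) = (δ_x f, δ_y f) + (δ_u f : u ∈ Γ ∖ {x, y})`.** [cite: Giraud1983, 1.1 (2)] -/
theorem derivJacobianIdeal_eq_span_dual (h : IsPBasisOver p (frobenius O p).range Γ) (f : O) :
    derivJacobianIdeal O f = Ideal.span ({δ ⟨x, hx⟩ f, δ ⟨y, hy⟩ f} ∪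
      {v : O | ∃ γ : Γ, (γ : O) ≠ x ∧ (γ : O) ≠ y ∧ δ γ f = v}) := by
  unfold derivJacobianIdeal
  exact span_derivation_apply_eq_span_dual δ hδ₁ hδ₀ hx hy h f

omit [Fact p.Prime] [CharP O p] in
/-- A derivation preserves `(z)` iff `z ∣ D z`. [folklore] -/
theorem forall_mem_span_singleton_iff_dvd (D : Derivation ℤ O O) (z : O) :
    (∀ a ∈ Ideal.span ({z} : Set O), D a ∈ Ideal.span ({z} : Set O)) ↔ z ∣ D z := by
  constructor
  · intro h
    exact Ideal.mem_span_singleton.mp (h z (Ideal.mem_span_singleton_self z))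
  · intro hz a ha
    obtain ⟨b, rfl⟩ := Ideal.mem_span_singleton'.mp ha
    rw [Derivation.leibniz, smul_eq_mul, smul_eq_mul, Ideal.mem_span_singleton]
    exact dvd_add (dvd_mul_of_dvd_right hz _) (dvd_mul_right _ _)

include hδ₁ hδ₀ in
/-- **`J(O, f, E(f)) = (x δ_x f, δ_y f) + N` when the only critical prime is `(x)`** (a
non-crossing point of `E(f) = div(x)`). [cite: Giraud1983, 1.1 (3) and 2.5] -/
theorem logDerivJacobianIdeal_eq_span_dual_of_criticalPrimes_eq
    (h : IsPBasisOver p (frobenius O p).range Γ) (hxy : x ≠ y) (f : O)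
    (hcrit : ∀ P : Ideal O, P ∈ derivCriticalPrimes O f ↔ P = Ideal.span {x}) :
    logDerivJacobianIdeal O f = Ideal.span ({x * δ ⟨x, hx⟩ f, δ ⟨y, hy⟩ f} ∪
      {v : O | ∃ γ : Γ, (γ : O) ≠ x ∧ (γ : O) ≠ y ∧ δ γ f = v}) := by
  rw [← span_logDerivation_apply_eq_span_dual δ hδ₁ hδ₀ hx hy h hxy f]
  unfold logDerivJacobianIdeal
  congr 1
  ext v
  simp only [Set.mem_setOf_eq]
  constructor
  · rintro ⟨D, hD, rfl⟩
    exact ⟨D, (forall_mem_span_singleton_iff_dvd D x).mp (hD _ ((hcrit _).mpr rfl)), rfl⟩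
  · rintro ⟨D, hD, rfl⟩
    refine ⟨D, fun P hP => ?_, rfl⟩
    rw [(hcrit P).mp hP]
    exact (forall_mem_span_singleton_iff_dvd D x).mpr hD

include hδ₁ hδ₀ in
/-- **`J(O, f, E(f)) = (x δ_x f, y δ_y f) + N` when the critical primes are `{(x), (y)}`** (a
crossing point of `E(f) = div(xy)`). [cite: Giraud1983, 1.1 (3) and 2.5] -/
theorem logDerivJacobianIdeal_eq_span_dual_of_criticalPrimes_eq₂
    (h : IsPBasisOver p (frobenius O p).range Γ) (hxy : x ≠ y) (f : O)
    (hcrit : ∀ P : Ideal O, P ∈ derivCriticalPrimes O f ↔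
      (P = Ideal.span {x} ∨ P = Ideal.span {y})) :
    logDerivJacobianIdeal O f = Ideal.span ({x * δ ⟨x, hx⟩ f, y * δ ⟨y, hy⟩ f} ∪
      {v : O | ∃ γ : Γ, (γ : O) ≠ x ∧ (γ : O) ≠ y ∧ δ γ f = v}) := by
  rw [← span_logDerivation₂_apply_eq_span_dual δ hδ₁ hδ₀ hx hy h hxy f]
  unfold logDerivJacobianIdeal
  congr 1
  ext v
  simp only [Set.mem_setOf_eq]
  constructor
  · rintro ⟨D, hD, rfl⟩
    exact ⟨D, (forall_mem_span_singleton_iff_dvd D x).mp (hD _ ((hcrit _).mpr (Or.inl rfl))),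
      (forall_mem_span_singleton_iff_dvd D y).mp (hD _ ((hcrit _).mpr (Or.inr rfl))), rfl⟩
  · rintro ⟨D, hDx, hDy, rfl⟩
    refine ⟨D, fun P hP => ?_, rfl⟩
    rcases (hcrit P).mp hP with hP' | hP'
    · rw [hP']; exact (forall_mem_span_singleton_iff_dvd D x).mpr hDx
    · rw [hP']; exact (forall_mem_span_singleton_iff_dvd D y).mpr hDy

/-! ## `f` is a `p`-th power iff all `δ_γ f` vanish -/

include hδ₁ hδ₀ in
/-- **If every dual derivation kills `f`, then `f ∈ O^p`**: in the expansion `f = Σ c_b Γ^b` the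
relation `γ δ_γ f = Σ (b γ) c_b Γ^b = 0` and the independence of the monomials kill every `c_b`
with `b ≠ 0`. (Contrapositive of Giraud's "f n'est pas une puissance p-ième ⇒ df ≠ 0".)
[cite: Giraud1983, 1.4 (2) and 2.4] -/
theorem mem_range_frobenius_of_forall_dual_apply_eq_zero
    (h : IsPBasisOver p (frobenius O p).range Γ) {f : O} (hf : ∀ γ : Γ, δ γ f = 0) :
    f ∈ (frobenius O p).range := by
  classical
  obtain ⟨c, hc⟩ := IsPBasisOver.exists_monomial_expansion h f
  have hf' : ∑ b ∈ c.support, (c b : O) * (b.1).prod (fun γ n => ((γ : Γ) : O) ^ n) = f := hc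
  -- every coefficient with `b ≠ 0` vanishes
  have hli := IsPBasisOver.linearIndependent_monomial h
  have hcoef : ∀ b ∈ c.support, ∀ γ : Γ, b.1 γ ≠ 0 → False := by
    intro b hb γ hbγ
    have hrel : (γ : O) * δ γ f = 0 := by rw [hf γ, mul_zero]
    rw [← hf', mul_derivation_sum_monomial (δ γ) γ (hδ₁ γ) (hδ₀ γ) c.support (fun b => b.1) c]
      at hrel
    -- read the relation as a vanishing `O^p`-linear combination of monomials
    let g : {b : Γ →₀ ℕ // ∀ γ, b γ < p} → (frobenius O p).range := fun b =>
      ⟨((b.1 γ : ℕ) : O) * (c b : O), Subring.mul_mem _ (natCast_mem _ _) (c b).2⟩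
    have hrel' : ∑ b ∈ c.support, g b • (b.1).prod (fun γ n => ((γ : Γ) : O) ^ n) = 0 := by
      rw [← hrel]
      refine Finset.sum_congr rfl fun b _ => ?_
      rw [Subring.smul_def, smul_eq_mul]
      simp only [g]; ring
    have h0 := (linearIndependent_iff'.mp hli) c.support g hrel' b hb
    have h0' : ((b.1 γ : ℕ) : O) * (c b : O) = 0 := congrArg Subtype.val h0
    have hu : IsUnit ((b.1 γ : ℕ) : O) := isUnit_natCast_of_lt (b.2 γ) hbγ
    have hcb : (c b : O) = 0 := by
      have := congrArg (fun z => (↑hu.unit⁻¹ : O) * z) h0'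
      simpa [← mul_assoc, IsUnit.val_inv_mul] using this
    exact (Finsupp.mem_support_iff.mp hb) (Subtype.ext hcb)
  -- hence only `b = 0` contributes
  have hsupp : ∀ b ∈ c.support, b.1 = 0 := by
    intro b hb
    ext γ
    by_contra hbγ
    exact hcoef b hb γ hbγ
  rw [← hf']
  refine Subring.sum_mem _ fun b hb => ?_
  rw [hsupp b hb, Finsupp.prod_zero_index, mul_one]
  exact (c b).2

include hδ₁ hδ₀ in
/-- Hence **`J(O, f) ≠ 0` for `f ∉ O^p`**. [cite: Giraud1983, 2.4] -/
theorem derivJacobianIdeal_ne_bot (h : IsPBasisOver p (frobenius O p).range Γ) {f : O}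
    (hf : f ∉ (frobenius O p).range) : derivJacobianIdeal O f ≠ ⊥ := by
  intro hbot
  apply hf
  refine mem_range_frobenius_of_forall_dual_apply_eq_zero δ hδ₁ hδ₀ h fun γ => ?_
  have : δ γ f ∈ derivJacobianIdeal O f := Ideal.subset_span ⟨δ γ, rfl⟩
  rw [hbot] at this
  exact (Submodule.mem_bot O).mp this

include hδ₁ hδ₀ in
/-- And **`J(O, f, E(f)) ≠ 0` for `f ∉ O^p`** when `x` lies in every critical prime (then
`x · δ_γ f ∈ J(O, f, E(f))`, and `O^p ∌ f` gives some `δ_γ f ≠ 0`; `x` is not a zero divisor as a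
member of a `p`-basis of a domain — we assume `O` is a domain). [cite: Giraud1983, 2.4–2.5] -/
theorem logDerivJacobianIdeal_ne_bot [IsDomain O] (h : IsPBasisOver p (frobenius O p).range Γ)
    {f : O} (hf : f ∉ (frobenius O p).range) (hx0 : x ≠ 0)
    (hxP : ∀ P ∈ derivCriticalPrimes O f, x ∈ P) : logDerivJacobianIdeal O f ≠ ⊥ := by
  intro hbot
  apply hf
  refine mem_range_frobenius_of_forall_dual_apply_eq_zero δ hδ₁ hδ₀ h fun γ => ?_
  have hmem : x * δ γ f ∈ logDerivJacobianIdeal O f := by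
    refine Ideal.subset_span ⟨x • δ γ, fun P hP a _ => ?_, by rw [Derivation.smul_apply, smul_eq_mul]⟩
    rw [Derivation.smul_apply, smul_eq_mul]
    exact P.mul_mem_right _ (hxP P hP)
  rw [hbot] at hmem
  exact (mul_eq_zero.mp ((Submodule.mem_bot O).mp hmem)).resolve_left hx0

end Summit.ResolutionOfSingularities.ResolutionOfSingularities.Theorems.RadicialJung.CleanModels

end
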